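import Mathlib
import HarnessLib
import Summits.HubbardSuperconductivity.HubbardSuperconductivity.Theses.WeakCouplingBCS
import Summits.HubbardSuperconductivity.HubbardSuperconductivity.Theorems.WeakCouplingBCSDefs
import Summits.HubbardSuperconductivity.HubbardSuperconductivity.Theorems.WeakCouplingBCSWcbcsKohnLuttingerB1gMuWindow
import Summits.HubbardSuperconductivity.HubbardSuperconductivity.Theorems.ChiralWindowCwKLChiralWindowReductionHS
import Summits.HubbardSuperconductivity.HubbardSuperconductivity.Theorems.ChiralWindowCwKLChiralWindowBlockBounds
import Summits.HubbardSuperconductivity.HubbardSuperconductivity.Theorems.ChiralWindowCwKLChiralWindowCoverLogic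
import Summits.HubbardSuperconductivity.HubbardSuperconductivity.Theorems.ChiralWindowCwChannelInfContinuousAssembly
import Literature.MathematicalPhysics.QuantumLattice.HubbardPairEnergySublevel
import Literature.MathematicalPhysics.QuantumLattice.HubbardBandShellVolume

/-!
# Route `WeakCouplingBCS` — support item `WcbcsKohnLuttingerB1g` (stmt-HubbardSuperconductivity-0158):
# the item from an accepted certificate RECORD (Lean endpoint of the interval-arithmetic certificate)

`wcbcsKohnLuttingerB1g_of_klCertB1g : ∀ c : KLCert, c.checkB1g = true → c.EnclosuresB1g → WcbcsKohnLuttingerB1g`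
(window records) and `wcbcsKohnLuttingerB1g_of_klCertB1g_point` (ONE box, possibly a single chemical potential:
`0 < c.gamma`, every box passes `basicOKB1g ∧ b1gLeadsOK c.gamma`, `c.EnclosuresB1g`): strict `B1g` dominance at one
level `μ₀ ∈ (-4,0)` already gives a window, because the channel bottoms `μ ↦ channelInf ε₀ μ U χ` are continuous on the
band (`klb1g_continuousOn_channelInf`, assembled from the tree's `continuousOn_channelInf_of_kernel` and the two geometric
estimates `exists_torusSublevel_le`, `exists_shellVolume_le` of the Literature — exactly as in `cwChannelInfContinuous_proof`).

The certificate logic is the one landed by the crux line `Sketch` of the `ChiralWindow` route (stmt-…-1741):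
a rational record `KLCert` (`Theorems/ChiralWindowDefs.lean`) of trigonometric trial/deflation functions and, per box of
chemical potentials and per `D₄` channel, enclosures of four explicit integrals against the Fermi-curve measure; the
kernel-decidable checker turns them into certified bounds of the channel bottoms `channelInf ε₀ μ 1 χ`
(`stub_klBlockBounds`: Temple / far-channel lower bounds; this file adds the standalone Ritz upper bound
`klb1g_ritz_upper`, which needs only the norm and Rayleigh-numerator enclosures E1–E2 of a `ritzOK` block).  On every box
the checker `KLCert.checkB1g` (`Theorems/WeakCouplingBCSDefs.lean`) compares `B1g`'s Ritz upper bound `+ γ` with the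
certified lower bounds of `A1g, A2g, B2g, E`; the boxes cover a window `[μ₂, μ₁] ⊂ (-4,0)` (`kl_cvl_chain_cover`).
The passage from the `U = 1` window statement to the item (`wcbcsKohnLuttingerB1g_of_one_certificate`) is free of
analytic hypotheses: `U²`-homogeneity of the `B1g` bottom and the bare-`U` penalty `U² Λ₁(χ) ≤ Λ_U(χ)` for `0 < U ≤ 1`
(`klhs_channelInf_sq`, `klhs_sq_channelInf_one_le`, from the landed Hilbert–Schmidt frame `stub_klKernelHS`,
`stub_klFrameHS`, `stub_klMeanZero`, `stub_klD4Invariant`) and the doping/chemical-potential window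
`chemicalPotentialOfDensity_window`.  What remains for the item is the computation: a concrete record `c` with
`c.checkB1g = true` (by `decide`) and the certified enclosures `c.EnclosuresB1g` (gate cell `gate-hubbard-kl`,
HOME/CERT-LEAN.md: the engines of CERT-SREP/CERT-TABLE enclose exactly these integrals).

References: M. Reed, B. Simon, *Methods of Modern Mathematical Physics IV*, Thm. XIII.5 (Temple);
S. Raghu, S. A. Kivelson, D. J. Scalapino, Phys. Rev. B 81 (2010) 224505 (arXiv:1002.0591), §II (7), (13), §III Fig. 2.
-/

noncomputable section

-- the tree's namespace `Summit.<Summit>.<Problem>.Theorems` repeats the summit name by design (D-0017)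
set_option linter.dupNamespace false

namespace Summit.HubbardSuperconductivity.HubbardSuperconductivity.Theorems

open MeasureTheory Literature.MathematicalPhysics.QuantumLattice CwKLChiralWindow
open Summit.HubbardSuperconductivity.HubbardSuperconductivity.Theses.WeakCouplingBCS

/-! ### The Ritz upper bound of a block -/

/-- Pulling a scalar out of a quadratic form with kernel `K`:
`∫ (cΦ)(k) (∫ K(k,k') (cΦ)(k') dσ) dσ = c² ∫ Φ(k) (∫ K(k,k') Φ(k') dσ) dσ`. [folklore] -/
theorem klb1g_form_smul (σ : Measure Momentum) (K : Momentum → Momentum → ℝ) (Φ : Momentum → ℝ) (c : ℝ) :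
    ∫ k, c * Φ k * ∫ k', K k k' * (c * Φ k') ∂σ ∂σ = c ^ 2 * ∫ k, Φ k * ∫ k', K k k' * Φ k' ∂σ ∂σ := by
  have hin : ∀ k, ∫ k', K k k' * (c * Φ k') ∂σ = c * ∫ k', K k k' * Φ k' ∂σ := by
    intro k
    rw [← integral_const_mul]
    refine integral_congr_ae (Filter.Eventually.of_forall fun k' => ?_)
    ring
  simp_rw [hin]
  rw [← integral_const_mul]
  refine integral_congr_ae (Filter.Eventually.of_forall fun k => ?_)
  ring

/-- The `U = 1` pairing form is bounded below on the channel states (Hilbert–Schmidt frame), so `channelInf ε₀ μ 1 χ`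
is a genuine infimum. [folklore] -/
theorem klb1g_bddBelow {μ : ℝ} (hμ : μ ∈ Set.Ioo (-4 : ℝ) 0) (χ : D4Irrep) :
    BddBelow (pairingForm (squareDispersion 1 0) μ 1 '' {ψ | IsChannelState (squareDispersion 1 0) μ χ ψ}) := by
  set H : ℝ := Real.sqrt (∫ z, (lindhardFunction (squareDispersion 1 0) μ (z.1 + z.2)) ^ 2
      ∂(fermiCurveMeasure (squareDispersion 1 0) μ).prod (fermiCurveMeasure (squareDispersion 1 0) μ)) with hH
  refine ⟨-H, ?_⟩
  rintro x ⟨ψ, hψ, rfl⟩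
  obtain ⟨hsplit, hbd⟩ := stub_klFrameHS stub_klKernelHS μ hμ 1 ψ hψ.1
  rw [hsplit, hψ.2.1, one_mul] at *
  have := neg_abs_le (∫ k, ψ k * ∫ k', lindhardFunction (squareDispersion 1 0) μ (k + k') * ψ k'
        ∂fermiCurveMeasure (squareDispersion 1 0) μ ∂fermiCurveMeasure (squareDispersion 1 0) μ)
  nlinarith [sq_nonneg (∫ k, ψ k ∂fermiCurveMeasure (squareDispersion 1 0) μ)]

/-- **Ritz upper bound of a block** (`U = 1`): if the checker accepts the Ritz data of the block in the channel `χ`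
(`ritzOK`: trial in the harmonic pattern of `χ`, `0 < Nlo ≤ Nhi`, `Qlo ≤ Qhi < 0`, bare-`U` term only for `A1g`), the block
is in the equality case (`withU ∨ χ ≠ A1g`) and its Ritz enclosures E1–E2 hold at `μ ∈ (-4,0)`, then
`channelInf ε₀ μ 1 χ ≤ rhohi = max (Qhi/Nlo) (Qhi/Nhi)`: the normalised trial `Φ/‖Φ‖` is a channel state whose `U = 1`
pairing form is `Q/N` (mean zero off `A1g`, `stub_klMeanZero`; the full kernel `1 + χ₀` when `withU`). No Temple data
(`Thi`, `Hhi`, `beta`) are needed. [cite: RaghuKivelsonScalapino2010, §II (7) and (13)] -/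
theorem klb1g_ritz_upper {μ : ℝ} (hμ : μ ∈ Set.Ioo (-4 : ℝ) 0) (b : KLBlock) (tab : List KLTrig) (χ : D4Irrep)
    (hR : b.ritzOK tab χ = true) (hcase : b.withU = true ∨ χ ≠ D4Irrep.A1g) (hE : b.RitzEnclosure tab μ) :
    channelInf (squareDispersion 1 0) μ 1 χ ≤ ((b.rhohi : ℚ) : ℝ) := by
  have hR' := hR
  simp only [KLBlock.ritzOK, Bool.and_eq_true, decide_eq_true_eq] at hR'
  obtain ⟨⟨⟨⟨⟨⟨⟨-, -⟩, hfits⟩, hNlo⟩, -⟩, -⟩, hQhi⟩, hwu⟩ := hR'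
  obtain ⟨h1, h2, h3, h4⟩ := hE
  obtain ⟨hN, -, hρhi, hρhi0, -⟩ := kl_bkb_arith (Thi := 0) (T := 0) (by exact_mod_cast hNlo) (by exact_mod_cast hQhi)
    le_rfl h1 h2 h3 h4 le_rfl
  have hrhohi : ((b.rhohi : ℚ) : ℝ) = max ((b.Qhi : ℝ) / (b.Nlo : ℝ)) ((b.Qhi : ℝ) / (b.Nhi : ℝ)) := by
    push_cast [KLBlock.rhohi]; rfl
  rw [← hrhohi] at hρhi hρhi0
  -- the data
  set σ := fermiCurveMeasure (squareDispersion 1 0) μ with hσ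
  set Φ : Momentum → ℝ := b.trialFun tab with hΦ
  set N : ℝ := ∫ k, Φ k ^ 2 ∂σ with hNdef
  haveI hfin : IsFiniteMeasure σ := stub_klFiniteMeasure stub_klGradient stub_klHausdorffFinite μ hμ
  have hinv := stub_klD4Invariant stub_klGradient μ hμ
  have hΦmem : MemLp Φ 2 σ := kl_tr_toFun_memLp (klTab tab b.trial) hμ
  have hΦch : InChannel χ Φ := stub_klTrigChannel (klTab tab b.trial) χ hfits
  -- the normalised trial
  set c : ℝ := (Real.sqrt N)⁻¹ with hc
  have hsqrt : 0 < Real.sqrt N := Real.sqrt_pos.2 hN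
  have hc2N : c ^ 2 * N = 1 := by
    rw [hc, inv_pow, Real.sq_sqrt hN.le, inv_mul_cancel₀ hN.ne']
  have hc2 : 0 < c ^ 2 := by positivity
  set ψ : Momentum → ℝ := fun k => c * Φ k with hψ
  have hψmem : MemLp ψ 2 σ := hΦmem.const_mul c
  have hψch : InChannel χ ψ := by
    have h := kl_hc_inChannel_linear χ Φ Φ c 0 hΦch hΦch
    simpa using h
  have hψnorm : ∫ k, ψ k ^ 2 ∂σ = 1 := by
    simp only [hψ, mul_pow]
    rw [integral_const_mul]
    exact hc2N
  have hstate : IsChannelState (squareDispersion 1 0) μ χ ψ := ⟨hψmem, hψnorm, hψch⟩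
  -- its `U = 1` pairing form is `c² Q`
  have hval : pairingForm (squareDispersion 1 0) μ 1 ψ =
      c ^ 2 * ∫ k, Φ k * ∫ k', b.baseKernel μ k k' * Φ k' ∂σ ∂σ := by
    cases hw : b.withU with
    | true =>
      have hker : ∀ k k', b.baseKernel μ k k' = kohnLuttingerKernel (squareDispersion 1 0) μ 1 k k' := by
        intro k k'
        rw [KLBlock.baseKernel, hw, kl_cb_kernel_one]
        simp
      simp_rw [hker]
      rw [← klb1g_form_smul]
      rfl
    | false =>
      have hχ : χ ≠ D4Irrep.A1g := by
        rcases hcase with h | h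
        · rw [hw] at h; exact absurd h Bool.false_ne_true
        · exact h
      have hmean : ∫ k, ψ k ∂σ = 0 := (stub_klMeanZero _ _ hfin hinv χ ψ hχ hstate).2
      obtain ⟨hsplit, -⟩ := stub_klFrameHS stub_klKernelHS μ hμ 1 ψ hψmem
      have hker : ∀ k k', b.baseKernel μ k k' = lindhardFunction (squareDispersion 1 0) μ (k + k') := by
        intro k k'
        rw [KLBlock.baseKernel, hw]
        simp
      simp_rw [hker]
      rw [hsplit, hmean, ← klb1g_form_smul σ _ Φ c]
      norm_num
      rfl
  -- conclude
  have hQ : c ^ 2 * ∫ k, Φ k * ∫ k', b.baseKernel μ k k' * Φ k' ∂σ ∂σ ≤ ((b.rhohi : ℚ) : ℝ) := by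
    calc c ^ 2 * ∫ k, Φ k * ∫ k', b.baseKernel μ k k' * Φ k' ∂σ ∂σ
        ≤ c ^ 2 * (((b.rhohi : ℚ) : ℝ) * N) := mul_le_mul_of_nonneg_left hρhi hc2.le
      _ = ((b.rhohi : ℚ) : ℝ) * (c ^ 2 * N) := by ring
      _ = ((b.rhohi : ℚ) : ℝ) := by rw [hc2N, mul_one]
  unfold channelInf
  exact (csInf_le (klb1g_bddBelow hμ χ) ⟨ψ, hstate, rfl⟩).trans (hval.le.trans hQ)

/-! ### From a `U = 1` window certificate to the item -/

/-- **`WcbcsKohnLuttingerB1g` from a `U = 1` certificate on a chemical-potential window.** If `-4 < μ₂ < μ₁ < 0`,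
`γ > 0` and, for every `μ ∈ [μ₂, μ₁]` and every channel `χ ≠ B1g`,
`channelInf ε₀ μ 1 B1g + γ ≤ channelInf ε₀ μ 1 χ`, then the route item holds verbatim (doping window
`[1 - n(μ₁), 1 - n(μ₂)]`, `U₁ = 1`): for `0 < U < 1`, `Λ_U(B1g) = U² Λ₁(B1g)` (`B1g` states have mean zero) and
`U² Λ₁(χ) ≤ Λ_U(χ)` (bare-`U` penalty). No analytic hypotheses (Hilbert–Schmidt frame, finiteness and `D₄`-invariance of
the Fermi-curve measure are theorems of the tree). [cite: RaghuKivelsonScalapino2010, §III Fig. 2] -/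
theorem wcbcsKohnLuttingerB1g_of_one_certificate {μ₁ μ₂ γ : ℝ} (h4 : -4 < μ₂) (h12 : μ₂ < μ₁) (h0 : μ₁ < 0)
    (hγ : 0 < γ)
    (hcert : ∀ μ ∈ Set.Icc μ₂ μ₁, ∀ χ : D4Irrep, χ ≠ D4Irrep.B1g →
      channelInf (squareDispersion 1 0) μ 1 D4Irrep.B1g + γ ≤ channelInf (squareDispersion 1 0) μ 1 χ) :
    WcbcsKohnLuttingerB1g := by
  unfold WcbcsKohnLuttingerB1g
  obtain ⟨ha, hab, hb, hwin⟩ := chemicalPotentialOfDensity_window h4 h12 h0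
  refine ⟨_, _, γ, 1, ha, hab, hb, hγ, one_pos, fun δ hδ U hU χ hχ => ?_⟩
  set m := chemicalPotentialOfDensity (squareDispersion 1 0) (1 - δ) with hm
  have hmI : m ∈ Set.Icc μ₂ μ₁ := hwin δ hδ
  have hmo : m ∈ Set.Ioo (-4 : ℝ) 0 := ⟨lt_of_lt_of_le h4 hmI.1, lt_of_le_of_lt hmI.2 h0⟩
  have hK := stub_klKernelHS
  have hfin : IsFiniteMeasure (fermiCurveMeasure (squareDispersion 1 0) m) :=
    stub_klFiniteMeasure stub_klGradient stub_klHausdorffFinite m hmo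
  have hinv := stub_klD4Invariant stub_klGradient m hmo
  have hhom : channelInf (squareDispersion 1 0) m U D4Irrep.B1g =
      U ^ 2 * channelInf (squareDispersion 1 0) m 1 D4Irrep.B1g :=
    klhs_channelInf_sq hK hmo U D4Irrep.B1g
      (fun ψ hψ => (stub_klMeanZero _ _ hfin hinv D4Irrep.B1g ψ (by decide) hψ).2)
  have hpen : U ^ 2 * channelInf (squareDispersion 1 0) m 1 χ ≤ channelInf (squareDispersion 1 0) m U χ :=
    klhs_sq_channelInf_one_le hK hmo hU.1 hU.2.le χ
  have h1 := mul_le_mul_of_nonneg_left (hcert m hmI χ hχ) (sq_nonneg U)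
  rw [hhom]
  nlinarith

/-! ### From an accepted record to the item -/

/-- **One box.** If a box passes `basicOKB1g` and `b1gLeadsOK γ`, then at every `μ` of the box where the Ritz enclosures of
the `B1g` block and the block enclosures of the four other channels hold,
`channelInf ε₀ μ 1 B1g + γ ≤ channelInf ε₀ μ 1 χ` for `χ ≠ B1g` (Ritz upper bound `klb1g_ritz_upper` against the certified
lower bounds `stub_klBlockBounds`). [folklore] -/
theorem klb1g_box_certificate {μ : ℝ} (bx : KLBox) (tab : List KLTrig) (γ : ℚ)
    (hB : bx.basicOKB1g tab = true) (hL : bx.b1gLeadsOK tab γ = true)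
    (hμ : μ ∈ Set.Icc ((bx.mulo : ℚ) : ℝ) ((bx.muhi : ℚ) : ℝ))
    (hER : bx.bB1g.RitzEnclosure tab μ) (hE : ∀ χ : D4Irrep, χ ≠ D4Irrep.B1g → (bx.blk χ).Enclosure tab μ χ) :
    ∀ χ : D4Irrep, χ ≠ D4Irrep.B1g →
      channelInf (squareDispersion 1 0) μ 1 D4Irrep.B1g + ((γ : ℚ) : ℝ) ≤ channelInf (squareDispersion 1 0) μ 1 χ := by
  have hB' := hB
  simp only [KLBox.basicOKB1g, Bool.and_eq_true, decide_eq_true_eq] at hB'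
  obtain ⟨⟨⟨⟨⟨⟨⟨h4, -⟩, h0⟩, hritz⟩, hA1⟩, hA2⟩, hB2⟩, hEE⟩ := hB'
  have hμ' : μ ∈ Set.Ioo (-4 : ℝ) 0 :=
    ⟨lt_of_lt_of_le (by exact_mod_cast h4) hμ.1, lt_of_le_of_lt hμ.2 (by exact_mod_cast h0)⟩
  have hup : channelInf (squareDispersion 1 0) μ 1 D4Irrep.B1g ≤ ((bx.bB1g.upper : ℚ) : ℝ) :=
    klb1g_ritz_upper hμ' bx.bB1g tab D4Irrep.B1g hritz (Or.inr (by decide)) hER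
  have hL' := hL
  simp only [KLBox.b1gLeadsOK, Bool.and_eq_true, decide_eq_true_eq] at hL'
  obtain ⟨⟨⟨hlA1, hlA2⟩, hlB2⟩, hlE⟩ := hL'
  have key : ∀ (χ : D4Irrep) (b : KLBlock), χ ≠ D4Irrep.B1g → bx.blk χ = b → b.lowerOK tab χ = true →
      bx.bB1g.upper + γ ≤ b.lower tab χ →
      channelInf (squareDispersion 1 0) μ 1 D4Irrep.B1g + ((γ : ℚ) : ℝ) ≤ channelInf (squareDispersion 1 0) μ 1 χ := by
    intro χ b hχ hb hok hle
    have hlow := (stub_klBlockBounds μ hμ' (bx.blk χ) tab χ (hE χ hχ)).1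
    rw [hb] at hlow
    have h2 := hlow hok
    have h3 : ((bx.bB1g.upper : ℚ) : ℝ) + ((γ : ℚ) : ℝ) ≤ ((b.lower tab χ : ℚ) : ℝ) := by exact_mod_cast hle
    linarith
  intro χ hχ
  cases χ with
  | A1g => exact key .A1g bx.bA1g (by decide) rfl hA1 hlA1
  | A2g => exact key .A2g bx.bA2g (by decide) rfl hA2 hlA2
  | B1g => exact absurd rfl hχ
  | B2g => exact key .B2g bx.bB2g (by decide) rfl hB2 hlB2
  | E => exact key .E bx.bE (by decide) rfl hEE hlE

/-- **Cover logic of `checkB1g`.** An accepted record has window ends `-4 < mub < mua < 0`, `gamma > 0`, every box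
passes `basicOKB1g ∧ b1gLeadsOK gamma`, and every real `μ ∈ [mub, mua]` lies in some box. [folklore] -/
theorem klb1g_coverLogic (c : KLCert) (hc : c.checkB1g = true) :
    (-4 < c.mub ∧ c.mub < c.mua ∧ c.mua < 0 ∧ 0 < c.gamma) ∧
    (∀ bx ∈ c.boxes, bx.basicOKB1g c.trials = true ∧ bx.b1gLeadsOK c.trials c.gamma = true) ∧
    (∀ μ : ℝ, ((c.mub : ℚ) : ℝ) ≤ μ → μ ≤ ((c.mua : ℚ) : ℝ) →
      ∃ bx ∈ c.boxes, ((bx.mulo : ℚ) : ℝ) ≤ μ ∧ μ ≤ ((bx.muhi : ℚ) : ℝ)) := by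
  unfold KLCert.checkB1g at hc
  simp only [Bool.and_eq_true, decide_eq_true_eq] at hc
  obtain ⟨⟨⟨⟨⟨⟨h₁, h₂⟩, h₃⟩, h₄⟩, hmatch⟩, hchain⟩, hall⟩ := hc
  refine ⟨⟨h₁, h₂, h₃, h₄⟩, ?_, ?_⟩
  · intro bx hbx
    have h := List.all_eq_true.1 hall bx hbx
    simp only [Bool.and_eq_true] at h
    exact ⟨h.1, h.2⟩
  · intro μ hμ₁ hμ₂
    split at hmatch
    · rename_i b₀ b₁ hb₀ hb₁
      simp only [Bool.and_eq_true, decide_eq_true_eq] at hmatch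
      obtain ⟨L, hL⟩ := List.head?_eq_some_iff.1 hb₀
      rw [hL] at hchain hb₁ ⊢
      have hlo : ((b₀.mulo : ℚ) : ℝ) ≤ μ := le_trans (by exact_mod_cast hmatch.1) hμ₁
      have hhi : μ ≤ ((b₁.muhi : ℚ) : ℝ) := le_trans hμ₂ (by exact_mod_cast hmatch.2)
      exact kl_cvl_chain_cover L b₀ b₁ hchain hb₁ μ hlo hhi
    · exact absurd hmatch Bool.false_ne_true

/-- **`WcbcsKohnLuttingerB1g` from an accepted record with certified enclosures** (the Lean endpoint of the
certificate): window `[c.mub, c.mua]`, margin `γ = c.gamma`, `U₁ = 1`. [cite: RaghuKivelsonScalapino2010, §III Fig. 2] -/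
theorem wcbcsKohnLuttingerB1g_of_klCertB1g : ∀ c : KLCert, c.checkB1g = true → c.EnclosuresB1g →
    WcbcsKohnLuttingerB1g := by
  intro c hc hE
  obtain ⟨⟨h4, h12, h0, hγ⟩, hboxes, hcover⟩ := klb1g_coverLogic c hc
  refine wcbcsKohnLuttingerB1g_of_one_certificate (μ₁ := ((c.mua : ℚ) : ℝ)) (μ₂ := ((c.mub : ℚ) : ℝ))
    (γ := ((c.gamma : ℚ) : ℝ)) (by exact_mod_cast h4) (by exact_mod_cast h12) (by exact_mod_cast h0)
    (by exact_mod_cast hγ) ?_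
  intro μ hμ χ hχ
  obtain ⟨bx, hbx, hlo, hhi⟩ := hcover μ hμ.1 hμ.2
  obtain ⟨hB, hL⟩ := hboxes bx hbx
  obtain ⟨hER, hEχ⟩ := hE bx hbx μ ⟨hlo, hhi⟩
  exact klb1g_box_certificate bx c.trials c.gamma hB hL ⟨hlo, hhi⟩ hER hEχ χ hχ

/-! ### A certificate at ONE chemical potential suffices: continuity of the channel bottoms in `μ` -/

/-- **The channel bottoms are continuous in the chemical potential on the band**: for every coupling `U` and channel
`χ`, `μ ↦ channelInf ε₀ μ U χ` is continuous on `(-4, 0)`.  This is the tree's `continuousOn_channelInf_of_kernel`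
(transport of channel states between Fermi curves + Hilbert–Schmidt control of the polar kernel) with its two kernel
inputs (K1) `M_μ ∈ L²(dθdθ')`, (K2) `∫∫ (M_μ - M_μ₀)² → 0` discharged by the torus-sublevel and shell-volume estimates of
the square-lattice band (`exists_torusSublevel_le`, `exists_shellVolume_le`, via `memLp_klKernelPolar`,
`tendsto_integral_sq_klKernelPolar_sub`) — verbatim the assembly of `cwChannelInfContinuous_proof`, stated on the band
instead of the doping window. [folklore] -/
theorem klb1g_continuousOn_channelInf (U : ℝ) (χ : D4Irrep) :
    ContinuousOn (fun μ => channelInf (squareDispersion 1 0) μ U χ) (Set.Ioo (-4 : ℝ) 0) := by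
  refine continuousOn_channelInf_of_kernel U χ (fun μ hμ => ?_) (fun μ₀ hμ₀ => ?_)
  · -- (K1) at `μ`: the degenerate sub-band `[μ, μ]`
    obtain ⟨C, β, hC, hβ0, hβ2, hT⟩ := exists_torusSublevel_le (μ₁ := μ) (μ₂ := μ) hμ.1 hμ.2
    obtain ⟨Csh, hCsh, hS⟩ := exists_shellVolume_le (μ₁ := μ) (μ₂ := μ) hμ.1 hμ.2
    exact memLp_klKernelPolar hμ.1 hμ.2 U hC hβ0 hβ2 hCsh (hT μ ⟨le_rfl, le_rfl⟩) (hS μ ⟨le_rfl, le_rfl⟩)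
  · -- (K2) at `μ₀`: the sub-band `[(μ₀ - 4)/2, μ₀/2] ∋ μ₀`
    have h1 : -4 < (μ₀ - 4) / 2 := by linarith [hμ₀.1]
    have h2 : μ₀ / 2 < 0 := by linarith [hμ₀.2]
    obtain ⟨C, β, hC, hβ0, hβ2, hT⟩ := exists_torusSublevel_le h1 h2
    obtain ⟨Csh, hCsh, hS⟩ := exists_shellVolume_le h1 h2
    exact tendsto_integral_sq_klKernelPolar_sub h1 h2 U hC hβ0 hβ2 hCsh hT hS
      ⟨by linarith [hμ₀.1], by linarith [hμ₀.2]⟩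

/-- **`WcbcsKohnLuttingerB1g` from a `U = 1` certificate at ONE chemical potential.** If `μ₀ ∈ (-4, 0)`, `γ > 0` and
`channelInf ε₀ μ₀ 1 B1g + γ ≤ channelInf ε₀ μ₀ 1 χ` for the four channels `χ ≠ B1g`, then the item holds: by
continuity of the five channel bottoms in `μ` (`klb1g_continuousOn_channelInf`) the dominance persists with margin
`γ/2` on a closed interval `[μ₀ - η, μ₀ + η] ⊂ (-4, 0)`, `η > 0`, and `wcbcsKohnLuttingerB1g_of_one_certificate`
applies. [cite: RaghuKivelsonScalapino2010, §III Fig. 2] -/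
theorem wcbcsKohnLuttingerB1g_of_point_certificate {μ₀ γ : ℝ} (hμ₀ : μ₀ ∈ Set.Ioo (-4 : ℝ) 0) (hγ : 0 < γ)
    (hcert : ∀ χ : D4Irrep, χ ≠ D4Irrep.B1g →
      channelInf (squareDispersion 1 0) μ₀ 1 D4Irrep.B1g + γ ≤ channelInf (squareDispersion 1 0) μ₀ 1 χ) :
    WcbcsKohnLuttingerB1g := by
  have hcont : ∀ χ : D4Irrep, ContinuousAt (fun μ => channelInf (squareDispersion 1 0) μ 1 χ) μ₀ :=
    fun χ => (klb1g_continuousOn_channelInf 1 χ).continuousAt (isOpen_Ioo.mem_nhds hμ₀)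
  have hev : ∀ᶠ μ in nhds μ₀, μ ∈ Set.Ioo (-4 : ℝ) 0 ∧
      ∀ χ : D4Irrep, dist (channelInf (squareDispersion 1 0) μ 1 χ) (channelInf (squareDispersion 1 0) μ₀ 1 χ) < γ / 4 := by
    refine (isOpen_Ioo.eventually_mem hμ₀).and (Filter.eventually_all.2 fun χ => ?_)
    exact Metric.tendsto_nhds.1 (hcont χ) (γ / 4) (by positivity)
  obtain ⟨η, hη0, hball⟩ := Metric.eventually_nhds_iff.1 hev
  have hin : ∀ μ ∈ Set.Icc (μ₀ - η / 2) (μ₀ + η / 2), dist μ μ₀ < η := by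
    intro μ hμ
    rw [Real.dist_eq, abs_lt]
    constructor <;> linarith [hμ.1, hμ.2]
  have hlo := (hball (hin (μ₀ - η / 2) ⟨le_rfl, by linarith⟩)).1
  have hhi := (hball (hin (μ₀ + η / 2) ⟨by linarith, le_rfl⟩)).1
  refine wcbcsKohnLuttingerB1g_of_one_certificate (μ₂ := μ₀ - η / 2) (μ₁ := μ₀ + η / 2) (γ := γ / 2)
    hlo.1 (by linarith) hhi.2 (by positivity) fun μ hμ χ hχ => ?_
  obtain ⟨-, hclose⟩ := hball (hin μ hμ)
  have h1 := hclose χ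
  have h2 := hclose D4Irrep.B1g
  have h3 := hcert χ hχ
  rw [Real.dist_eq, abs_lt] at h1 h2
  linarith [h1.1, h1.2, h2.1, h2.2]

/-- **One box at one level gives the item.** If a box passes `basicOKB1g` and `b1gLeadsOK γ` with `γ > 0`, and the Ritz
enclosures of its `B1g` block and the block enclosures of the four other channels hold at SOME `μ` of the box, then
`WcbcsKohnLuttingerB1g` (`klb1g_box_certificate` + `wcbcsKohnLuttingerB1g_of_point_certificate`). [folklore] -/
theorem wcbcsKohnLuttingerB1g_of_klBox_point (bx : KLBox) (tab : List KLTrig) (γ : ℚ) (hγ : 0 < γ)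
    (hB : bx.basicOKB1g tab = true) (hL : bx.b1gLeadsOK tab γ = true) {μ : ℝ}
    (hμ : μ ∈ Set.Icc ((bx.mulo : ℚ) : ℝ) ((bx.muhi : ℚ) : ℝ))
    (hER : bx.bB1g.RitzEnclosure tab μ) (hE : ∀ χ : D4Irrep, χ ≠ D4Irrep.B1g → (bx.blk χ).Enclosure tab μ χ) :
    WcbcsKohnLuttingerB1g := by
  have hB' := hB
  simp only [KLBox.basicOKB1g, Bool.and_eq_true, decide_eq_true_eq] at hB'
  obtain ⟨⟨⟨⟨⟨⟨⟨h4, -⟩, h0⟩, -⟩, -⟩, -⟩, -⟩, -⟩ := hB'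
  have hμ' : μ ∈ Set.Ioo (-4 : ℝ) 0 :=
    ⟨lt_of_lt_of_le (by exact_mod_cast h4) hμ.1, lt_of_le_of_lt hμ.2 (by exact_mod_cast h0)⟩
  exact wcbcsKohnLuttingerB1g_of_point_certificate hμ' (by exact_mod_cast hγ)
    (klb1g_box_certificate bx tab γ hB hL hμ hER hE)

/-- **`WcbcsKohnLuttingerB1g` from a ONE-LEVEL record with certified enclosures** (the cheapest Lean endpoint of the
certificate): a record `c` with `0 < c.gamma`, a non-empty box list all of whose boxes pass
`basicOKB1g ∧ b1gLeadsOK c.gamma` (kernel-decidable on a literal; `c.checkB1g` minus the window clauses, so a box with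
`mulo = muhi = μ₀` is admissible), and the enclosures `c.EnclosuresB1g`.  The first box at its left end `μ = mulo` is
used. [cite: RaghuKivelsonScalapino2010, §III Fig. 2] -/
theorem wcbcsKohnLuttingerB1g_of_klCertB1g_point (c : KLCert) (hγ : 0 < c.gamma)
    (hall : (c.boxes.all fun bx => bx.basicOKB1g c.trials && bx.b1gLeadsOK c.trials c.gamma) = true)
    (hne : c.boxes ≠ []) (hE : c.EnclosuresB1g) : WcbcsKohnLuttingerB1g := by
  obtain ⟨bx, L, hbL⟩ := List.exists_cons_of_ne_nil hne
  have hbx : bx ∈ c.boxes := by rw [hbL]; exact List.mem_cons_self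
  have h := List.all_eq_true.1 hall bx hbx
  simp only [Bool.and_eq_true] at h
  have hB' := h.1
  simp only [KLBox.basicOKB1g, Bool.and_eq_true, decide_eq_true_eq] at hB'
  obtain ⟨⟨⟨⟨⟨⟨⟨-, hle⟩, -⟩, -⟩, -⟩, -⟩, -⟩, -⟩ := hB'
  have hμ : ((bx.mulo : ℚ) : ℝ) ∈ Set.Icc ((bx.mulo : ℚ) : ℝ) ((bx.muhi : ℚ) : ℝ) :=
    ⟨le_rfl, by exact_mod_cast hle⟩
  obtain ⟨hER, hEχ⟩ := hE bx hbx _ hμ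
  exact wcbcsKohnLuttingerB1g_of_klBox_point bx c.trials c.gamma hγ h.1 h.2 hμ hER hEχ

end Summit.HubbardSuperconductivity.HubbardSuperconductivity.Theorems

end
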